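import Mathlib
import HarnessLib
import Summits.ValiantsHypothesis.ValiantsHypothesis.Theorems.KPlusLogSqLawWeakLiftingTowerGraftWronskianDevelopable

/-!
# Tower graft line — THE PLÜCKER-SUPPORT CHAMBER OF CONJECTURE W: `Z₊(W(u,v)) ≤ #{dₐ + d_b : a < b, p_{ab} ≠ 0} − 1`;
# at `K = 4` Conjecture W holds off the big cell of `Gr(2,4)` (one vanishing Plücker coordinate suffices)

Helper file for LINE (B) `Cruxes/WeakLifting/Lines/tower_graft.lean` (crux `WeakLifting` = stmt-ValiantsHypothesis-19561), on hand g9's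
CONJECTURE W «`Z₊(W(u,v)) ≤ 2K − 4`» (= the `k = 1` developable conjecture of [cite: SedykhShapiro2005] on lacunary moment arcs,
`…WronskianDevelopable`).  NO stub is claimed; the generic case stays open.

* `two_mul_coeff_X_mul_wronskian_fewnomial` — ANTISYMMETRISED pair-sum form, coefficientwise:
  `2·[Xⁿ](X·W(u,v)) = Σₐ Σ_b [n = dₐ + d_b]·p_{ab}·(d_b − dₐ)`, `p_{ab} = uₐv_b − u_b vₐ` the Plücker coordinates of `span(u,v)`.
* `support_X_mul_wronskian_subset_pluckerSums`, ★ `card_posRoots_wronskian_le_card_pluckerSums_sub_one` — the support of `X·W(u,v)`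
  lies in the PLÜCKER SUMSET `{dₐ + d_b : a < b, p_{ab} ≠ 0}`, so `Z₊(W(u,v)) ≤ #(Plücker sumset) − 1` (Descartes).  This contains the
  sumset chamber of `…WronskianDevelopable` (all `p_{ab}`) and the binomial chamber of `…WronskianBinomialPencil` (pairs meeting `{i,j}`).
* ★ `card_posRoots_wronskian_le_four_of_plucker_eq_zero` — **`K = 4`: if ONE Plücker coordinate `p_{ab}` (`a ≠ b`) of the pencil
  vanishes, then `Z₊(W(u,v)) ≤ 4 = 2K − 4` on EVERY support.**  So at `K = 4` Conjecture W is OPEN ONLY ON THE BIG CELL: generic planes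
  (all six `p_{ab} ≠ 0`) on unbalanced supports (`…WronskianDevelopable`), with the fully alternating pair-sum sign pattern (Descartes) —
  where the kernel holds `4 ≤ Z₊ ≤ 5` on the 2-tower `(0,1,3,20)` (`…WronskianTowerWitness`) and [cite: SedykhShapiro2005, Thm A] gives `4`
  for closed convex curves.

HONEST FRAMING: Descartes bookkeeping on the Plücker pair-sum form; nothing on S4/S4b/S4d/S4f/S5/S5ᴸ, TowerB, `WeakLifting`, Conjecture B,
`MatrixDescartes` (18050) or `VP ≠ VNP`.  Def-free.  Seat: prover leafhand-val-kpluslogsqlaw-1 g10, `--supports stmt-ValiantsHypothesis-19561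
--as helper`.  [folklore: Plücker form of the Wronskian, Descartes' rule; the chamber statements are this work]
-/

-- `Summit.ValiantsHypothesis.ValiantsHypothesis.…` repeats a component by the D-0017 layout
-- (single-conjunct summit), which the `dupNamespace` linter flags; the name is mandated.
set_option linter.dupNamespace false
set_option autoImplicit false

namespace Summit.ValiantsHypothesis.ValiantsHypothesis.Theorems.KPlusLogSqLaw.TowerGraft

open Polynomial Finset
open scoped BigOperators Polynomial

namespace WronskianDevelopable

/-- coefficient of `Xⁿ` in `X·W(u,v)`: `Σₐ Σ_b [n = dₐ + d_b]·uₐ v_b (d_b − dₐ)` (pair-sum form of `…InflectionLawSizeOne`). [this work] -/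
theorem coeff_X_mul_wronskian_fewnomial {K : ℕ} (u v : Fin K → ℝ) (d : Fin K → ℕ) (n : ℕ) :
    ((X : ℝ[X]) * wronskian (∑ l, C (u l) * X ^ d l) (∑ l, C (v l) * X ^ d l)).coeff n =
      ∑ a, ∑ b, if n = d a + d b then u a * v b * ((d b : ℝ) - d a) else 0 := by
  rw [InflectionLaw.X_mul_wronskian_fewnomial_eq, finsetSum_coeff]
  simp only [finsetSum_coeff, coeff_C_mul_X_pow]

/-- **antisymmetrised (Plücker) form, coefficientwise**: `2·[Xⁿ](X·W(u,v)) = Σₐ Σ_b [n = dₐ + d_b]·(uₐv_b − u_b vₐ)(d_b − dₐ)`.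
[folklore; kernel form this work] -/
theorem two_mul_coeff_X_mul_wronskian_fewnomial {K : ℕ} (u v : Fin K → ℝ) (d : Fin K → ℕ) (n : ℕ) :
    2 * ((X : ℝ[X]) * wronskian (∑ l, C (u l) * X ^ d l) (∑ l, C (v l) * X ^ d l)).coeff n =
      ∑ a, ∑ b, if n = d a + d b then (u a * v b - u b * v a) * ((d b : ℝ) - d a) else 0 := by
  rw [coeff_X_mul_wronskian_fewnomial]
  have hcomm : (∑ a, ∑ b, if n = d a + d b then u a * v b * ((d b : ℝ) - d a) else 0) =
      ∑ a, ∑ b, if n = d b + d a then u b * v a * ((d a : ℝ) - d b) else 0 := Finset.sum_comm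
  rw [two_mul]
  nth_rewrite 2 [hcomm]
  rw [← Finset.sum_add_distrib]
  refine Finset.sum_congr rfl fun a _ => ?_
  rw [← Finset.sum_add_distrib]
  refine Finset.sum_congr rfl fun b _ => ?_
  by_cases h : n = d a + d b
  · have h' : n = d b + d a := by rw [h, add_comm]
    rw [if_pos h, if_pos h', if_pos h]
    ring
  · have h' : ¬ n = d b + d a := by rwa [add_comm]
    rw [if_neg h, if_neg h', if_neg h]
    ring

/-- **the support of `X·W(u,v)` lies in the PLÜCKER SUMSET** `{dₐ + d_b : a < b, uₐv_b − u_b vₐ ≠ 0}`. [this work] -/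
theorem support_X_mul_wronskian_subset_pluckerSums {K : ℕ} (u v : Fin K → ℝ) (d : Fin K → ℕ) :
    ((X : ℝ[X]) * wronskian (∑ l, C (u l) * X ^ d l) (∑ l, C (v l) * X ^ d l)).support ⊆
      ((Finset.univ : Finset (Fin K × Fin K)).filter (fun p => p.1 < p.2 ∧ u p.1 * v p.2 - u p.2 * v p.1 ≠ 0)).image
        (fun p => d p.1 + d p.2) := by
  intro n hn
  rw [mem_support_iff] at hn
  by_contra hmem
  apply hn
  have h2 := two_mul_coeff_X_mul_wronskian_fewnomial u v d n
  suffices hzero : ∑ a, ∑ b, (if n = d a + d b then (u a * v b - u b * v a) * ((d b : ℝ) - d a) else 0) = 0 by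
    rw [hzero] at h2; linarith
  refine Finset.sum_eq_zero fun a _ => Finset.sum_eq_zero fun b _ => ?_
  split_ifs with h
  · rcases lt_trichotomy a b with hab | hab | hab
    · by_cases hp : u a * v b - u b * v a = 0
      · rw [hp, zero_mul]
      · exact (hmem (Finset.mem_image.mpr ⟨(a, b), Finset.mem_filter.mpr ⟨Finset.mem_univ _, hab, hp⟩, h.symm⟩)).elim
    · subst hab; simp
    · by_cases hp : u b * v a - u a * v b = 0
      · have : u a * v b - u b * v a = 0 := by linarith
        rw [this, zero_mul]
      · exact (hmem (Finset.mem_image.mpr ⟨(b, a), Finset.mem_filter.mpr ⟨Finset.mem_univ _, hab, hp⟩,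
          by rw [add_comm]; exact h.symm⟩)).elim
  · rfl

/-- **THE PLÜCKER-SUPPORT CHAMBER**: `Z₊(W(u,v)) ≤ #{dₐ + d_b : a < b, p_{ab} ≠ 0} − 1`. [this work] -/
theorem card_posRoots_wronskian_le_card_pluckerSums_sub_one {K : ℕ} (u v : Fin K → ℝ) (d : Fin K → ℕ) :
    ((wronskian (∑ l, C (u l) * X ^ d l) (∑ l, C (v l) * X ^ d l)).roots.toFinset.filter (fun x => 0 < x)).card ≤
      (((Finset.univ : Finset (Fin K × Fin K)).filter (fun p => p.1 < p.2 ∧ u p.1 * v p.2 - u p.2 * v p.1 ≠ 0)).image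
        (fun p => d p.1 + d p.2)).card - 1 := by
  rw [← InflectionLaw.card_posRoots_X_mul]
  refine (LacunarySymmetroidMatrixDescartes.FiniteSector.card_posRoots_le_card_support_sub_one _).trans ?_
  exact Nat.sub_le_sub_right (Finset.card_le_card (support_X_mul_wronskian_subset_pluckerSums u v d)) 1

/-- the strict pairs of `Fin 4` with one pair removed number at most `5`. [this work] -/
theorem card_pairs_fin_four_erase_le (P : Fin 4 × Fin 4 → Prop) [DecidablePred P] (a b : Fin 4) (hab : a < b)
    (hP : ¬ P (a, b)) :
    ((Finset.univ : Finset (Fin 4 × Fin 4)).filter (fun p => p.1 < p.2 ∧ P p)).card ≤ 5 := by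
  have hsub : (Finset.univ : Finset (Fin 4 × Fin 4)).filter (fun p => p.1 < p.2 ∧ P p) ⊆
      ((Finset.univ : Finset (Fin 4 × Fin 4)).filter (fun p => p.1 < p.2)).erase (a, b) := by
    intro p hp
    rw [Finset.mem_filter] at hp
    rw [Finset.mem_erase, Finset.mem_filter]
    refine ⟨?_, Finset.mem_univ _, hp.2.1⟩
    rintro rfl
    exact hP hp.2.2
  refine (Finset.card_le_card hsub).trans ?_
  have hmem : (a, b) ∈ (Finset.univ : Finset (Fin 4 × Fin 4)).filter (fun p => p.1 < p.2) :=
    Finset.mem_filter.mpr ⟨Finset.mem_univ _, hab⟩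
  rw [Finset.card_erase_of_mem hmem]
  have h6 : ((Finset.univ : Finset (Fin 4 × Fin 4)).filter (fun p => p.1 < p.2)).card = 6 := by decide
  omega

/-- ★ **`K = 4`: one vanishing Plücker coordinate gives Conjecture W.**  If `p_{ab} = uₐv_b − u_b vₐ = 0` for some `a ≠ b`, then
`Z₊(W(u,v)) ≤ 4 = 2K − 4` on EVERY support `d : Fin 4 → ℕ` — Conjecture W at `K = 4` is open only on the big cell of `Gr(2,4)`.
[this work] -/
theorem card_posRoots_wronskian_le_four_of_plucker_eq_zero (u v : Fin 4 → ℝ) (d : Fin 4 → ℕ) (a b : Fin 4) (hab : a ≠ b)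
    (hp : u a * v b - u b * v a = 0) :
    ((wronskian (∑ l, C (u l) * X ^ d l) (∑ l, C (v l) * X ^ d l)).roots.toFinset.filter (fun x => 0 < x)).card ≤ 4 := by
  refine (card_posRoots_wronskian_le_card_pluckerSums_sub_one u v d).trans ?_
  -- order the pair
  have key : ∀ a b : Fin 4, a < b → u a * v b - u b * v a = 0 →
      (((Finset.univ : Finset (Fin 4 × Fin 4)).filter (fun p => p.1 < p.2 ∧ u p.1 * v p.2 - u p.2 * v p.1 ≠ 0)).image
        (fun p => d p.1 + d p.2)).card ≤ 5 := by
    intro a b hab hp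
    refine Finset.card_image_le.trans ?_
    exact card_pairs_fin_four_erase_le (fun p => u p.1 * v p.2 - u p.2 * v p.1 ≠ 0) a b hab (by simpa using hp)
  rcases lt_or_gt_of_ne hab with h | h
  · have := key a b h hp; omega
  · have hp' : u b * v a - u a * v b = 0 := by linarith
    have := key b a h hp'; omega

end WronskianDevelopable

end Summit.ValiantsHypothesis.ValiantsHypothesis.Theorems.KPlusLogSqLaw.TowerGraft
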